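import Mathlib

/-!
# A binomial tail estimate

`2ⁿ ≤ 2 Σ_{i ≤ n/2 − s} C(n,i) + 2 s C(n, n/2)` for `s ≤ n/2`: writing `k = n/2 − s`,
`2ⁿ = Σ_{i ≤ n} C(n,i) = Σ_{i ≤ k} C(n,i) + Σ_{k < i ≤ n} C(n,i)`, the second block equals
`Σ_{j < n − k} C(n,j)` by the symmetry `C(n,i) = C(n,n−i)`, and `Σ_{j < n−k} C(n,j)` exceeds
`Σ_{j ≤ k} C(n,j)` by at most `n − 2k − 1 ≤ 2s` binomial coefficients, each at most the middle one
`C(n, n/2)`. Helper for line Sketch/LAR of crux stmt-QuantumAdvantage-1392 (the deficit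
`2ⁿ − 2 dim lowDeg (n/2 − s)` is at most `2s` middle binomial coefficients).
-/

namespace Summit.QuantumAdvantage.DigitPolyUniformity.SketchLAR

open Finset

namespace TwoPowLe

/-- An initial segment of a row of Pascal's triangle exceeds a shorter initial segment by at most
(number of extra terms) `×` (the middle binomial coefficient):
`Σ_{i < b} C(n,i) ≤ Σ_{i < a} C(n,i) + (b − a) C(n, n/2)`. [folklore] -/
theorem sum_range_choose_le_add (n a b : ℕ) :
    ∑ i ∈ range b, n.choose i ≤ ∑ i ∈ range a, n.choose i + (b - a) * n.choose (n / 2) := by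
  rcases le_total b a with hba | hab
  · exact (Finset.sum_le_sum_of_subset (range_subset_range.2 hba)).trans (Nat.le_add_right _ _)
  · rw [← Finset.sum_range_add_sum_Ico _ hab]
    refine Nat.add_le_add_left ?_ _
    calc ∑ i ∈ Ico a b, n.choose i ≤ ∑ _i ∈ Ico a b, n.choose (n / 2) :=
          Finset.sum_le_sum fun i _ => Nat.choose_le_middle i n
      _ = (b - a) * n.choose (n / 2) := by
          rw [Finset.sum_const, smul_eq_mul, Nat.card_Ico]

/-- The symmetry of a row of Pascal's triangle, summed over a final segment: for `k ≤ n`,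
`Σ_{k < i ≤ n} C(n,i) = Σ_{j < n − k} C(n,j)`. [folklore] -/
theorem sum_Ico_choose_eq_sum_range (n k : ℕ) (hk : k ≤ n) :
    ∑ i ∈ Ico (k + 1) (n + 1), n.choose i = ∑ j ∈ range (n - k), n.choose j := by
  have h := Finset.sum_Ico_reflect n.choose 0 (m := n - k) (n := n) (by omega)
  rw [show n + 1 - (n - k) = k + 1 by omega, Nat.sub_zero] at h
  rw [← h, range_eq_Ico]
  refine Finset.sum_congr rfl fun j hj => ?_
  rw [Finset.mem_Ico] at hj
  exact Nat.choose_symm (by omega)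

/-- A row of Pascal's triangle folded at `k ≤ n`:
`2ⁿ = Σ_{i ≤ k} C(n,i) + Σ_{j < n − k} C(n,j)`. [folklore] -/
theorem two_pow_eq_sum_add_sum (n k : ℕ) (hk : k ≤ n) :
    2 ^ n = ∑ i ∈ range (k + 1), n.choose i + ∑ j ∈ range (n - k), n.choose j := by
  rw [← Nat.sum_range_choose, ← sum_Ico_choose_eq_sum_range n k hk,
    Finset.sum_range_add_sum_Ico _ (by omega)]

end TwoPowLe

/-- **Binomial tail estimate.** For `s ≤ n/2`:
`2ⁿ ≤ 2 Σ_{i ≤ n/2 − s} C(n,i) + 2 s C(n, n/2)` — the full row `2ⁿ = Σ_i C(n,i)` is twice the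
initial segment up to `n/2 − s` plus at most `2s` further terms, each at most the middle
coefficient `C(n, n/2)`. [folklore] -/
theorem stub_two_pow_le (n s : ℕ) (hs : s ≤ n / 2) :
    2 ^ n ≤ 2 * ∑ i ∈ range (n / 2 - s + 1), n.choose i + 2 * s * n.choose (n / 2) := by
  have hk : n / 2 - s + s = n / 2 := Nat.sub_add_cancel hs
  set k := n / 2 - s with hkdef
  have hkn : k ≤ n := by omega
  have ht : n - k - (k + 1) ≤ 2 * s := by omega
  calc 2 ^ n = ∑ i ∈ range (k + 1), n.choose i + ∑ j ∈ range (n - k), n.choose j :=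
        TwoPowLe.two_pow_eq_sum_add_sum n k hkn
    _ ≤ ∑ i ∈ range (k + 1), n.choose i +
          (∑ i ∈ range (k + 1), n.choose i + (n - k - (k + 1)) * n.choose (n / 2)) :=
        Nat.add_le_add_left (TwoPowLe.sum_range_choose_le_add n (k + 1) (n - k)) _
    _ ≤ ∑ i ∈ range (k + 1), n.choose i +
          (∑ i ∈ range (k + 1), n.choose i + 2 * s * n.choose (n / 2)) :=
        Nat.add_le_add_left (Nat.add_le_add_left (Nat.mul_le_mul_right _ ht) _) _
    _ = 2 * ∑ i ∈ range (k + 1), n.choose i + 2 * s * n.choose (n / 2) := by ring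

end Summit.QuantumAdvantage.DigitPolyUniformity.SketchLAR
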